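import Summits.QuantumFields.YangMills.Theorems.CurvatureAmnesia.Negative.SigmaFiveRotation
import Summits.QuantumFields.YangMills.Theorems.PencilRigidityAxisMirrorsInsufficient

/-!
# `CurvatureAmnesia` — negative side IV: the two-point shadow of the model-blind form is FALSE
(unconditionally)

Standing disprover of crux `stmt-QuantumFields-16192`, cycle 1, file 4. Files 1–3 show that the crux with its two
lattice clauses deleted is false MODULO the existence of one isotropic massive OS family. This file records the
finite-dimensional, hypothesis-free shadow of the same fact in degree two: the guards of the crux that survive
the deletion of the Wilson tie — evenness (E3), the signed permutations, reflection positivity at positive times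
(E2 in degree `(1,1)`), exponential clustering in time (the degree-`(1,1)` content of `HasMassGap`) and
non-triviality — are ALL satisfied by the `ℓ¹`-exponential kernel `K(z) = exp(−Σ_μ |z_μ|)` (the two-point
function of the `W(B₄)`-symmetric generalised free field `∏_μ (1 − ∂_μ²)⁻¹`), which is not invariant under the
Σ5 rotation `R` of the crux: `K(R e₂) = e^{−7/5} ≠ e^{−1} = K(e₂)`.

The kernel, its continuity and its OS-positivity (`kernel_osPositive`: Ornstein–Uhlenbeck kernel + Schur products)
are REUSED from `PencilRigidityAxisMirrorsInsufficient` (calibration Z1 of route `PencilRigidity`, where the same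
kernel defeats the four axis mirrors with the half-vector reflection); new here are the `IsHyper` form of the
signed-permutation invariance, the time-clustering bound and the Σ5 computation.

MORAL (briefing): nothing short of the lattice tie constrains the ANGULAR dependence of `𝔖₂` either; the crux's Σ5
content starts in degree two (contrast `NPointIsotropy`, where the radial-kernel hypothesis makes degree two free,
`NPointIsotropy.Negative.radialKernel_invariant_two`).
-/

noncomputable section

-- Mathlib's `SimplexCategory` instance `Fintype (Fin (x.len + 1))` matches `Fintype (Fin 4)` and makes concrete
-- `Fin 4` instance paths diverge between elaborations (tree-known workaround, cf. `NPointIsotropy.Negative`).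
attribute [-instance] SimplexCategory.instFintypeToTypeOrderHomFinHAddNatLenOfNat

namespace Summit.QuantumFields.YangMills.Theorems.CurvatureAmnesia.Negative

open scoped BigOperators
open Literature.MathematicalPhysics.QuantumLattice
open Summit.QuantumFields.YangMills.Theorems.NPointIsotropy.Negative
open Summit.QuantumFields.YangMills.Theorems.AxisMirrorsInsufficient (continuous_kernel kernel_osPositive)

/-- `K(z) = exp(−Σ_μ |z_μ|)` is even. [folklore] -/
theorem kernel_neg (z : E4) : Real.exp (-∑ μ, |(-z) μ|) = Real.exp (-∑ μ, |z μ|) := by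
  simp [abs_neg]

/-- `Σ_μ |z_μ|` is invariant under the signed permutations `sp τ δ`. [folklore] -/
theorem sum_abs_sp (τ : Equiv.Perm (Fin 4)) (δ : Fin 4 → Bool) (z : E4) :
    ∑ μ, |sp τ δ z μ| = ∑ μ, |z μ| := by
  simp only [sp_apply, abs_mul, abs_sgn, one_mul]
  exact Equiv.sum_comp τ.symm (fun i => |z i|)

/-- `K` is invariant under every axis-permuting isometry (`IsHyper`, the crux's signed-permutation guard without
the determinant condition). [folklore] -/
theorem kernel_hyper {R : E4 ≃ₗᵢ[ℝ] E4} (hR : IsHyper R) (z : E4) :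
    Real.exp (-∑ μ, |R z μ|) = Real.exp (-∑ μ, |z μ|) := by
  obtain ⟨τ, δ, hτ⟩ := exists_sp_of_isHyper hR
  rw [hτ z, sum_abs_sp]

/-- **Exponential clustering of `K` in time**: `|K(z)| ≤ e^{−|z⁰|}`. [folklore] -/
theorem abs_kernel_le_exp_time (z : E4) : |Real.exp (-∑ μ, |z μ|)| ≤ 1 * Real.exp (-(1 * |z 0|)) := by
  rw [abs_of_pos (Real.exp_pos _), one_mul, one_mul, Real.exp_le_exp, neg_le_neg_iff]
  exact Finset.single_le_sum (fun i _ => abs_nonneg (z i)) (Finset.mem_univ 0)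

/-- `K(e₂) = e^{−1}` but `K(R e₂) = e^{−7/5}`: `K` is NOT invariant under the Σ5 rotation. [folklore] -/
theorem kernel_Rσ_e2_ne : Real.exp (-∑ μ, |Rσ (e 2) μ|) ≠ Real.exp (-∑ μ, |e 2 μ|) := by
  have h1 : ∑ μ, |e 2 μ| = 1 := by
    simp [Fin.sum_univ_four, e]
  have h2 : ∑ μ, |Rσ (e 2) μ| = 7 / 5 := by
    have hR : Rσ (e 2) = (3/5 : ℝ) • e 2 + (4/5 : ℝ) • e 3 := Rσ_e2
    rw [hR]
    simp [Fin.sum_univ_four, e]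
    norm_num [abs_of_pos]
  rw [h1, h2, Ne, Real.exp_eq_exp]
  norm_num

/-- **The two-point shadow of the model-blind form of `CurvatureAmnesia`.** A continuous even kernel `K` on
`ℝ⁴` — the would-be two-point Schwinger function `𝔖₂(x, y) = K(x − y)` of one hermitian scalar field
(translation invariance built in; evenness is E3 in degree two) — which is invariant under the axis-permuting
isometries (the crux's signed-permutation guard, indeed all of `W(B₄)`), reflection positive at positive times with
real test vectors (E2 in degree `(1,1)`; for a real symmetric kernel real and complex test vectors agree),
exponentially clustering in time (the degree-`(1,1)` content of `HasMassGap`) and non-zero (non-triviality), is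
invariant under the Σ5 rotation `Rσ`. FALSE: `not_twoPointShadow`. -/
def TwoPointShadow : Prop :=
  ∀ K : E4 → ℝ, Continuous K → (∀ z, K (-z) = K z) →
    (∀ R : E4 ≃ₗᵢ[ℝ] E4, IsHyper R → ∀ z, K (R z) = K z) →
    (∀ (n : ℕ) (x : Fin n → E4) (c : Fin n → ℝ), (∀ i, 0 < x i 0) →
      0 ≤ ∑ i, ∑ j, c i * c j * K (timeReflection 4 (x i) - x j)) →
    (∃ C m : ℝ, 0 < m ∧ ∀ z, |K z| ≤ C * Real.exp (-(m * |z 0|))) →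
    K 0 ≠ 0 →
    ∀ z, K (Rσ z) = K z

/-- **Theorem (the two-point shadow is false, unconditionally).** Witness `K = exp(−Σ_μ |z_μ|)`. Hence, already in
degree two, the guards of the crux other than the Wilson tie do not force Σ5-blindness. [folklore] -/
theorem not_twoPointShadow : ¬ TwoPointShadow := fun h =>
  kernel_Rσ_e2_ne (h (fun z => Real.exp (-∑ μ, |z μ|)) continuous_kernel kernel_neg
    (fun _ hR z => kernel_hyper hR z) (fun n x c hx => kernel_osPositive n x c hx)
    ⟨1, 1, one_pos, abs_kernel_le_exp_time⟩ (by simp) (e 2))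

end Summit.QuantumFields.YangMills.Theorems.CurvatureAmnesia.Negative

end
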